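import Mathlib
import Summits.Ventures.PercRepro2.Defs
import Summits.Ventures.PercRepro2.Graph
import Summits.Ventures.PercRepro2.OneColourSwitch
import Summits.Ventures.PercRepro2.SideSwitch
import Summits.Ventures.PercRepro2.Independence
import Summits.Ventures.PercRepro2.M9LoopTransfer
import Summits.Ventures.PercRepro2.M9NoPocketDefs
import Summits.Ventures.PercRepro2.M9LoopRS
import Summits.Ventures.PercRepro2.M9YSliceDefs
import Summits.Ventures.PercRepro2.M9YSliceK
import Summits.Ventures.PercRepro2.M9YSliceO

/-!
# Theorem Y without the `r–s` hypothesis (blind cell PercRepro2, p3 g26, 2026-08-28;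
`proofs/P3-YSLICE.md` §1, §3)

Looping an `r–s` edge halves the `Y`-slice exactly as it halves the single-`d` sum
(`ySlice_loop_rs`, the lane's `dSignSum_loop_rs` with the slice predicate carried along: the
edge is not at `d`), so the `r–s` edges can be looped away one by one and **Theorem Y holds on
every finite multigraph**: `Σ_{Sep ∧ DOne(d), every edge at d is Y} σ_pq · σ_rs ≤ 0` for every
non-mark `d` (`ySlice_nonpos'`; `r = s` is trivial, `ySlice_self`).  Own work; std axioms.
-/

namespace Summit.Ventures.PercRepro2

namespace NoPocket

open Finset Classical OneColourSwitch SideSwitch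

variable {V : Type*} {E : Type*}
variable [Fintype V] [DecidableEq V] [Fintype E] [DecidableEq E]

variable {ends : E → Sym2 V}

omit [Fintype V] [DecidableEq V] [Fintype E] in
/-- The slice predicate does not see the colour of an edge not at `d`. -/
lemma starY_update_of_not_mem {d : V} {ω : Config E} {e : E} (he : d ∉ ends e) (b : Bool) :
    StarY ends d (Function.update ω e b) ↔ StarY ends d ω := by
  unfold StarY
  constructor
  · intro h e' hde hnd
    have hne : e' ≠ e := by rintro rfl; exact he hde
    rw [← Function.update_of_ne hne (v := b) (f := ω)]
    exact h e' hde hnd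
  · intro h e' hde hnd
    have hne : e' ≠ e := by rintro rfl; exact he hde
    rw [Function.update_of_ne hne]
    exact h e' hde hnd

omit [Fintype V] [DecidableEq V] [Fintype E] in
/-- The slice predicate does not see the looping of an `r–s` edge. -/
lemma starY_loopRS {r s d : V} {e : E} (he : ends e = s(r, s)) (hr : d ≠ r) (hs : d ≠ s)
    (ω : Config E) : StarY (loopRS ends r e) d ω ↔ StarY ends d ω := by
  have hde : d ∉ ends e := by
    rw [he, Sym2.mem_iff]; rintro (h | h)
    · exact hr h
    · exact hs h
  have hde' : d ∉ loopRS ends r e e := by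
    simp only [loopRS, Function.update_self, Sym2.mem_iff]
    rintro (h | h) <;> exact hr h
  unfold StarY
  constructor
  · intro h e' hd hnd
    have hne : e' ≠ e := by rintro rfl; exact hde hd
    have := h e' (by rw [loopRS, Function.update_of_ne hne]; exact hd)
      (by rw [loopRS, Function.update_of_ne hne]; exact hnd)
    exact this
  · intro h e' hd hnd
    have hne : e' ≠ e := by rintro rfl; exact hde' hd
    rw [loopRS, Function.update_of_ne hne] at hd hnd
    exact h e' hd hnd

/-- **Looping an `r–s` edge halves the `Y`-slice**: `2 · ySlice = ySlice (e looped)`. -/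
theorem ySlice_loop_rs {p q r s d : V} {e : E} (he : ends e = s(r, s)) (hr : d ≠ r)
    (hs : d ≠ s) : 2 * ySlice ends p q r s d = ySlice (loopRS ends r e) p q r s d := by
  unfold ySlice
  set F : Config E → ℤ := fun ω => if sep2 ends p q r s ω ∧ DOne ends r s d ω ∧
    StarY ends d ω then sigma ends ω p q * sigma ends ω r s else 0 with hF
  have hre : ∑ ω, F (flipEdge e ω) = ∑ ω, F ω := sum_flipEdge e F
  have h2 : 2 * ∑ ω, F ω = ∑ ω, (F ω + F (flipEdge e ω)) := by
    rw [Finset.sum_add_distrib, hre]; ring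
  rw [h2]
  refine Finset.sum_congr rfl fun ω _ => ?_
  simp only [hF, flipEdge_apply]
  have hde : d ∉ ends e := by
    rw [he, Sym2.mem_iff]; rintro (h | h)
    · exact hr h
    · exact hs h
  have hK : ∀ ω₁ ω₂ : Config E, (∀ e', e' ≠ e → ω₁ e' = ω₂ e') →
      K2 (loopRS ends r e) r s ω₁ = K2 (loopRS ends r e) r s ω₂ := by
    intro ω₁ ω₂ h12
    have : ω₂ = Function.update ω₁ e (ω₂ e) := by
      funext e'
      by_cases hh : e' = e
      · rw [hh, Function.update_self]
      · rw [Function.update_of_ne hh, h12 e' hh]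
    rw [this]
    ext x
    rw [mem_K2_iff, mem_K2_iff]
    simp only [conn_loopRS_update]
  have hagree : ∀ e', e' ≠ e → ω e' = Function.update ω e (!ω e) e' :=
    fun e' h => by rw [Function.update_of_ne h]
  have hagreeC : ∀ e', e' ≠ e → OneColourSwitch.compl ω e' =
      OneColourSwitch.compl (Function.update ω e (!ω e)) e' :=
    fun e' h => by simp [OneColourSwitch.compl, Function.update_of_ne h]
  have hsep : sep2 ends p q r s ω ↔ sep2 ends p q r s (Function.update ω e (!ω e)) := by
    rw [sep2_loopRS he, sep2_loopRS he]
    simp only [sep2, sepY, M9Reduce.compl_update, conn_loopRS_update]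
  have hD : DOne ends r s d ω ↔ DOne ends r s d (Function.update ω e (!ω e)) := by
    rw [DOne_loopRS he, DOne_loopRS he]
    simp only [DOne]
    rw [hK ω _ hagree, show M2 (loopRS ends r e) r s ω =
      M2 (loopRS ends r e) r s (Function.update ω e (!ω e)) from hK _ _ hagreeC]
  have hY : StarY ends d ω ↔ StarY ends d (Function.update ω e (!ω e)) :=
    (starY_update_of_not_mem hde _).symm
  have hpq : sigma (loopRS ends r e) (Function.update ω e (!ω e)) p q =
      sigma (loopRS ends r e) ω p q := by
    unfold sigma
    simp only [M9Reduce.compl_update, conn_loopRS_update]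
    by_cases h1 : Conn (loopRS ends r e) ω p q <;>
      by_cases h2 : Conn (loopRS ends r e) (OneColourSwitch.compl ω) p q <;> simp [h1, h2]
  by_cases hL : sep2 ends p q r s ω ∧ DOne ends r s d ω ∧ StarY ends d ω
  · have hL' : sep2 ends p q r s (Function.update ω e (!ω e)) ∧
        DOne ends r s d (Function.update ω e (!ω e)) ∧
        StarY ends d (Function.update ω e (!ω e)) :=
      ⟨hsep.1 hL.1, hD.1 hL.2.1, hY.1 hL.2.2⟩
    have hLl : sep2 (loopRS ends r e) p q r s ω ∧ DOne (loopRS ends r e) r s d ω ∧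
        StarY (loopRS ends r e) d ω :=
      ⟨(sep2_loopRS he ω).1 hL.1, (DOne_loopRS he ω).1 hL.2.1, (starY_loopRS he hr hs ω).2 hL.2.2⟩
    rw [if_pos hL, if_pos hL', if_pos hLl, sigma_pq_loopRS he hL.1, sigma_pq_loopRS he hL'.1,
      hpq, ← mul_add, sigma_rs_add_flip he]
  · have hL' : ¬ (sep2 ends p q r s (Function.update ω e (!ω e)) ∧
        DOne ends r s d (Function.update ω e (!ω e)) ∧
        StarY ends d (Function.update ω e (!ω e))) :=
      fun h => hL ⟨hsep.2 h.1, hD.2 h.2.1, hY.2 h.2.2⟩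
    have hLl : ¬ (sep2 (loopRS ends r e) p q r s ω ∧ DOne (loopRS ends r e) r s d ω ∧
        StarY (loopRS ends r e) d ω) :=
      fun h => hL ⟨(sep2_loopRS he ω).2 h.1, (DOne_loopRS he ω).2 h.2.1,
        (starY_loopRS he hr hs ω).1 h.2.2⟩
    rw [if_neg hL, if_neg hL', if_neg hLl, add_zero]

omit [Fintype V] [DecidableEq V] in
/-- The `Y`-slice vanishes when `r = s`. -/
lemma ySlice_self (p q r d : V) : ySlice ends p q r r d = 0 := by
  unfold ySlice
  refine Finset.sum_eq_zero (fun ω _ => ?_)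
  have h : sigma ends ω r r = 0 := by
    simp [sigma, conn_refl]
  rw [h, mul_zero, ite_self]

/-- **Theorem Y on every finite multigraph**: for every non-mark `d`,
`Σ_{Sep ∧ DOne(d), every edge at d is Y} σ_pq · σ_rs ≤ 0`. -/
theorem ySlice_nonpos' {p q r s d : V} (hr : d ≠ r) (hs : d ≠ s) (hp : p ≠ d) :
    ySlice ends p q r s d ≤ 0 := by
  by_cases hrs : r = s
  · subst hrs
    rw [ySlice_self]
  suffices key : ∀ n : ℕ, ∀ ends : E → Sym2 V,
      (univ.filter (fun e => ends e = s(r, s))).card = n → ySlice ends p q r s d ≤ 0 from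
    key _ ends rfl
  intro n
  induction n using Nat.strong_induction_on with
  | _ n ih =>
    intro ends hn
    by_cases hex : ∃ e, ends e = s(r, s)
    · obtain ⟨e, he⟩ := hex
      have hloop := ySlice_loop_rs (p := p) (q := q) he hr hs
      have hmem : e ∈ univ.filter (fun e => ends e = s(r, s)) := by simp [he]
      have hsub : univ.filter (fun e' => loopRS ends r e e' = s(r, s)) ⊆
          (univ.filter (fun e' => ends e' = s(r, s))).erase e := by
        intro e' he'
        rw [Finset.mem_filter] at he'
        have hne : e' ≠ e := by
          rintro rfl
          simp only [loopRS, Function.update_self, Sym2.eq_iff] at he'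
          rcases he'.2 with ⟨_, h⟩ | ⟨h, _⟩ <;> exact hrs h
        rw [Finset.mem_erase, Finset.mem_filter]
        refine ⟨hne, Finset.mem_univ _, ?_⟩
        rw [← he'.2, loopRS, Function.update_of_ne hne]
      have hlt : (univ.filter (fun e' => loopRS ends r e e' = s(r, s))).card < n := by
        have h1 := Finset.card_le_card hsub
        rw [Finset.card_erase_of_mem hmem, hn] at h1
        have hpos : 0 < n := by
          rw [← hn]; exact Finset.card_pos.2 ⟨e, hmem⟩
        omega
      have := ih _ hlt (loopRS ends r e) rfl
      linarith
    · exact ySlice_nonpos hr hs hp (fun e h => hex ⟨e, h⟩)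

end NoPocket

end Summit.Ventures.PercRepro2
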